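import Mathlib
import HarnessLib
import Summits.QuantumAdvantage.AdviceFreeQNC0.OddPrimeStatements
import Summits.QuantumAdvantage.AdviceFreeQNC0.WalkTransport
import Summits.QuantumAdvantage.AdviceFreeQNC0.WalkHardFJunta
import Summits.QuantumAdvantage.AdviceFreeQNC0.KernelFibration
import Summits.QuantumAdvantage.AdviceFreeQNC0.TwoBlindSpotsFlip
import Summits.QuantumAdvantage.AdviceFreeQNC0.TwoBlindSpots
import Summits.QuantumAdvantage.QuantumAdvantage.Theorems.AbsorptionDialA
import Summits.QuantumAdvantage.QuantumAdvantage.Theorems.RigidityLawsB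
import Summits.QuantumAdvantage.QuantumAdvantage.Theorems.PairFreezingA
import Literature.Computability.MetaComplexity.LowDegreeComposition
import Summits.QuantumAdvantage.AdviceFreeQNC0.WindowLadderBlocks

/-!
# OrderDial (part A) — ORDER mechanics of the u-walk game and THE PADDING CALCULUS (Prop-free support laws)

Cell decomp-qadv, lens 4, g16; tree twin of the node `Theses draft OrderDial.lean` rev 2 (§1, §2, §8, §9-mechanics, §10-mechanics),
`--supports` route-QuantumAdvantage-AbsorptionDial item 28489 `MassHiQuarter` (line material; no item is proved or referenced here).

* §1–§2: relabelled strategies `permStrat σ y`, win counts `wins`, `symWins`; 𝔽_p-degree is invariant under relabelling.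
* §8: the game isomorphism — playing `y∘σ` against the fixed-order walk IS playing `y` against the walk reading the bits in order σ
  (`ringWinU_permStrat`, `wins_permStrat`, `symWins_eq_sum_orders`, `ordered_wins_le_of_T`).
* §9 NULL PAIRS: the two-slot gadget `N = [u₀ ≠ u₁]` at walk slots 0, 2 never wins in the identity order (`ringWinU_nullPair`,
  `wins_xor_nullPair`) yet `Σ_σ wins(N∘σ) ≥ n!·2ⁿ/24` (`symWins_nullPair_ge`); `wins_le_losses_add`; ℕ/ℝ forms of T's bound.
  (The Prop-level consequence «order comparison ≡ T» lives in the node file.)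
* §10 LOSS PADDING: `pad c r₀ h` = the absorbing pair (`Theorems.AbsorptionDial.absorb`) of an even triple plants losses exactly on
  `supp h ∩ {|w| ≢ r₀ (mod 3)}` (`ringWinU_xor_pad`); the prefix selector, its support count and designer-set bound; thresholds.
  (The Prop-level padding law `PadClosed 𝒩 → RestrictedT 𝒩 → T` lives in the node file.)

0 sorry · no `instance` · no `notation` · no `native_decide` · axioms standard (guards at the end).
-/

set_option linter.dupNamespace false

open Finset
open Literature.Computability.MetaComplexity Literature.Computability.MetaComplexity.Smolensky
open Summit.QuantumAdvantage.AdviceFreeQNC0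

namespace Summit.QuantumAdvantage.QuantumAdvantage.Theorems.OrderDial


/-! ## §1 Objects: relabelled strategies, win counts, the symmetrised win count -/

/-- the strategy `y` read through the coordinate relabelling `σ`: `(y∘σ)_g(u) = y_g(u ∘ σ)`. -/
def permStrat {n : ℕ} (σ : Equiv.Perm (Fin n)) (y : Fin (n + 1) → (Fin n → Bool) → Bool) :
    Fin (n + 1) → (Fin n → Bool) → Bool :=
  fun g u => y g (fun i => u (σ i))

/-- number of inputs won at charge `c` (fixed-order game `ringWinU`). -/
def wins {n : ℕ} (c : ℕ) (y : Fin (n + 1) → (Fin n → Bool) → Bool) : ℕ :=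
  (univ.filter fun u : Fin n → Bool => ringWinU c y u = true).card

/-- symmetrised win count: total wins, in the fixed-order game, of all `n!` relabellings `y∘σ`. -/
def symWins {n : ℕ} (c : ℕ) (y : Fin (n + 1) → (Fin n → Bool) → Bool) : ℕ :=
  ∑ σ : Equiv.Perm (Fin n), wins c (permStrat σ y)

/-- OrderDialAA helper `permStrat_one` (decomp-qadv land package; see the module docstring). -/
@[simp] theorem permStrat_one {n : ℕ} (y : Fin (n + 1) → (Fin n → Bool) → Bool) :
    permStrat (1 : Equiv.Perm (Fin n)) y = y := by
  funext g u; simp [permStrat]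

/-- OrderDialAA helper `permStrat_mul` (decomp-qadv land package; see the module docstring). -/
theorem permStrat_mul {n : ℕ} (σ τ : Equiv.Perm (Fin n)) (y : Fin (n + 1) → (Fin n → Bool) → Bool) :
    permStrat (σ * τ) y = permStrat σ (permStrat τ y) := by
  funext g u; simp [permStrat, Equiv.Perm.mul_apply]

/-- OrderDialAA helper `wins_le_two_pow` (decomp-qadv land package; see the module docstring). -/
theorem wins_le_two_pow {n : ℕ} (c : ℕ) (y : Fin (n + 1) → (Fin n → Bool) → Bool) : wins c y ≤ 2 ^ n := by
  unfold wins
  calc (univ.filter fun u : Fin n → Bool => ringWinU c y u = true).card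
      ≤ (univ : Finset (Fin n → Bool)).card := Finset.card_filter_le _ _
    _ = 2 ^ n := by simp

/-- wins + losses = 2ⁿ. -/
theorem wins_add_losses {n : ℕ} (c : ℕ) (y : Fin (n + 1) → (Fin n → Bool) → Bool) :
    wins c y + (univ.filter fun u : Fin n → Bool => ringWinU c y u = false).card = 2 ^ n := by
  have h1 := Finset.card_filter_add_card_filter_not (s := (univ : Finset (Fin n → Bool)))
    (fun u : Fin n → Bool => ringWinU c y u = true)
  simp only [Bool.not_eq_true, Finset.card_univ, Fintype.card_fun, Fintype.card_bool, Fintype.card_fin] at h1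
  exact h1

/-! ## §2 Degree is invariant under relabelling (twin of lens-4 g6 `PurityDialLaw.hasDegF_permFn`) -/

variable {p : ℕ} [Fact p.Prime]

/-- `𝔽_p`-degree is invariant under a permutation of the coordinates. -/
theorem hasDegF_comp_perm {n d : ℕ} (σ : Equiv.Perm (Fin n)) {f : (Fin n → Bool) → Bool}
    (hf : HasDegF p f d) : HasDegF p (fun u => f (fun i => u (σ i))) d := by
  have hcoord : ∀ i : Fin n,
      (fun u : Fin n → Bool => if (fun j => u (σ j)) i = true then (1 : ZMod p) else 0) ∈ lowDeg (ZMod p) n 1 := by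
    intro i
    have : (fun u : Fin n → Bool => if (fun j => u (σ j)) i = true then (1 : ZMod p) else 0) =
        mono (ZMod p) ({σ i} : Finset (Fin n)) := by
      funext u; rw [mono_apply]; simp
    rw [this]; exact mono_mem_lowDeg (by simp)
  exact Smolensky.comp_mem_lowDeg_of_coord (fun u : Fin n → Bool => fun j => u (σ j)) hcoord hf

/-- every relabelling of a degree-`d` strategy is a degree-`d` strategy. -/
theorem hasDegF_permStrat {n d : ℕ} (σ : Equiv.Perm (Fin n)) {y : Fin (n + 1) → (Fin n → Bool) → Bool}
    (hy : ∀ g, HasDegF p (y g) d) (g : Fin (n + 1)) : HasDegF p (permStrat σ y g) d :=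
  hasDegF_comp_perm σ (hy g)

/-! ## §8 The game isomorphism (kernel): playing `y∘σ` against the fixed-order walk IS playing `y` against the walk
that reads coordinate `i` at time `σ i` — so `symWins c y` is the number of (order, input) pairs won by `y`, and T for one
order is T for every order.  This is what makes W_ord an honest AVERAGE over isomorphic games and R_ord a derandomisation. -/

/-- prefix weight when coordinate `i` is read at time `ρ i`: the number of `1`-bits read before cut `g`. -/
def wtPrefixOrd {n : ℕ} (ρ : Equiv.Perm (Fin n)) (v : Fin n → Bool) (g : ℕ) : ℕ :=
  (univ.filter fun i : Fin n => (ρ i).val < g ∧ v i = true).card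

/-- WIN of the u-walk game whose hidden walk reads the bits in the order given by the rank function `ρ`
(`ρ = 1` is `ringWinU`: `ringWinOrd_one`). -/
def ringWinOrd {n : ℕ} (ρ : Equiv.Perm (Fin n)) (c : ℕ) (y : Fin (n + 1) → (Fin n → Bool) → Bool)
    (v : Fin n → Bool) : Bool :=
  decide ((univ.filter fun g : Fin (n + 1) =>
    y g v = true ∧ (c + g.val + (wt v + wtPrefixOrd ρ v g.val)) % 3 ≠ 0).card % 2 = 1)

/-- OrderDialAA helper `wtPrefixOrd_one` (decomp-qadv land package; see the module docstring). -/
theorem wtPrefixOrd_one {n : ℕ} (v : Fin n → Bool) (g : ℕ) : wtPrefixOrd (1 : Equiv.Perm (Fin n)) v g = wtPrefix v g := by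
  simp [wtPrefixOrd, wtPrefix]

/-- OrderDialAA helper `ringWinOrd_one` (decomp-qadv land package; see the module docstring). -/
theorem ringWinOrd_one {n : ℕ} (c : ℕ) (y : Fin (n + 1) → (Fin n → Bool) → Bool) (v : Fin n → Bool) :
    ringWinOrd 1 c y v = ringWinU c y v := by
  simp [ringWinOrd, ringWinU, walkExp, wtPrefixOrd_one]

/-- total weight is order-free. -/
theorem wt_comp_perm {n : ℕ} (σ : Equiv.Perm (Fin n)) (u : Fin n → Bool) : wt (fun i => u (σ i)) = wt u := by
  unfold wt
  refine Finset.card_bij (fun i _ => σ i) ?_ ?_ ?_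
  · intro i hi; simpa using hi
  · intro i₁ _ i₂ _ h; exact σ.injective h
  · intro j hj; exact ⟨σ.symm j, by simpa using hj, by simp⟩

/-- the fixed-order prefix weight of `u` is the `σ`-ordered prefix weight of `u ∘ σ`. -/
theorem wtPrefix_eq_wtPrefixOrd {n : ℕ} (σ : Equiv.Perm (Fin n)) (u : Fin n → Bool) (g : ℕ) :
    wtPrefix u g = wtPrefixOrd σ (fun i => u (σ i)) g := by
  unfold wtPrefix wtPrefixOrd
  symm
  refine Finset.card_bij (fun i _ => σ i) ?_ ?_ ?_
  · intro i hi; simpa using hi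
  · intro i₁ _ i₂ _ h; exact σ.injective h
  · intro j hj
    refine ⟨σ.symm j, ?_, by simp⟩
    simpa using hj

/-- **GAME ISOMORPHISM.**  `y∘σ` wins the fixed-order game on `u` iff `y` wins the `σ`-ordered game on `u ∘ σ`. -/
theorem ringWinU_permStrat {n : ℕ} (σ : Equiv.Perm (Fin n)) (c : ℕ) (y : Fin (n + 1) → (Fin n → Bool) → Bool)
    (u : Fin n → Bool) : ringWinU c (permStrat σ y) u = ringWinOrd σ c y (fun i => u (σ i)) := by
  unfold ringWinU ringWinOrd permStrat walkExp
  rw [wt_comp_perm σ u]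
  congr 1
  simp_rw [wtPrefix_eq_wtPrefixOrd σ u]

/-- hence the wins of `y∘σ` (fixed order) are the wins of `y` in the `σ`-ordered game … -/
theorem wins_permStrat {n : ℕ} (σ : Equiv.Perm (Fin n)) (c : ℕ) (y : Fin (n + 1) → (Fin n → Bool) → Bool) :
    wins c (permStrat σ y) = (univ.filter fun v : Fin n → Bool => ringWinOrd σ c y v = true).card := by
  unfold wins
  refine Finset.card_bij (fun u _ => fun i => u (σ i)) ?_ ?_ ?_
  · intro u hu
    simp only [Finset.mem_filter, Finset.mem_univ, true_and] at hu ⊢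
    rwa [← ringWinU_permStrat]
  · intro u₁ _ u₂ _ h
    funext j
    have := congrFun h (σ.symm j)
    simpa using this
  · intro v hv
    refine ⟨fun j => v (σ.symm j), ?_, ?_⟩
    · simp only [Finset.mem_filter, Finset.mem_univ, true_and] at hv ⊢
      rw [ringWinU_permStrat]
      have h : (fun i => (fun j => v (σ.symm j)) (σ i)) = v := by funext i; simp
      rw [h]; exact hv
    · funext i; simp

/-- … and `symWins c y` = the number of (order, input) pairs won by `y`: W_ord bounds y's MEAN win rate over the n!
isomorphic ordered games, T bounds it in ONE of them. -/
theorem symWins_eq_sum_orders {n : ℕ} (c : ℕ) (y : Fin (n + 1) → (Fin n → Bool) → Bool) :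
    symWins c y = ∑ ρ : Equiv.Perm (Fin n), (univ.filter fun v : Fin n → Bool => ringWinOrd ρ c y v = true).card := by
  unfold symWins
  exact Finset.sum_congr rfl fun σ _ => wins_permStrat σ c y

/-- T read in any one order is T (the value of the ordered game does not depend on the order): the order-`ρ` win count
of `y` is the fixed-order win count of the legal strategy `y∘ρ`. -/
theorem ordered_wins_le_of_T {n k d : ℕ} (c : ℕ) (ρ : Equiv.Perm (Fin n))
    (hT : ∀ y : Fin (n + 1) → (Fin n → Bool) → Bool, (∀ g, HasDegF p (y g) d) →
      (wins c y : ℝ) ≤ (1 - 1 / (n : ℝ) ^ k) * (2 : ℝ) ^ n)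
    (y : Fin (n + 1) → (Fin n → Bool) → Bool) (hy : ∀ g, HasDegF p (y g) d) :
    ((univ.filter fun v : Fin n → Bool => ringWinOrd ρ c y v = true).card : ℝ) ≤ (1 - 1 / (n : ℝ) ^ k) * (2 : ℝ) ^ n := by
  rw [← wins_permStrat]
  exact hT (permStrat ρ y) (hasDegF_permStrat ρ hy)


/-! ## §9 (g16) NULL PAIRS — identity-invisible shots that every other order sees; the ORDER-COMPARISON residual is
T in costume (kernel; answers critic row 66v17 (c))

A *null pair* `N` fires the selector `[u₀ ≠ u₁]` at walk slots 0 and 2.  In the identity order the two labels are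
`c + |u|` and `c + 2 + |u| + [u₀] + [u₁] ≡ c + |u| (mod 3)`, so the pair contributes 0 or 2 live cuts: `N` NEVER wins,
and `y ⊕ N` has exactly the wins of `y` (`wins_xor_nullPair`), at degree `d + 2`.  Read through a relabelling `σ` that
moves the selector's two coordinates off `{0, 1}`, the pair fires on `[u_a ≠ u_b]` while its labels still differ by
`2 + [u₀] + [u₁]`: it wins on ≥ 2ⁿ/8 inputs (`wins_pair02_xor_ge`, two halving involutions and one residue-moving bit
flip), and three double transpositions move every `σ` to such a position, so `Σ_σ wins(N∘σ) ≥ n!·2ⁿ/24`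
(`symWins_nullPair_ge`) although `wins(N) = 0`: ORDER-FRAGILITY for free.  Consequence (`orderCompOdd_iff_walkPolyLossOdd`):
the order-comparison statement «identity-order loss ≥ n^(−k) × order-averaged loss» is EQUIVALENT to T — pad any `y`
with `N`; `y` and `y ⊕ N` have the same identity loss, and their order-averaged losses together cover `symWins N`. -/

section NullPair
variable {n : ℕ}

/-- `W₂(u) = [u₀] + [u₁]`. -/
theorem wtPrefix_two (u : Fin (n + 2) → Bool) :
    wtPrefix u 2 = (if u ⟨0, by omega⟩ = true then 1 else 0) + (if u ⟨1, by omega⟩ = true then 1 else 0) := by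
  have h1 := Theorems.PairFreezing.wtPrefix_succ u (g := 1) (by omega)
  have h0 := Theorems.PairFreezing.wtPrefix_succ u (g := 0) (by omega)
  rw [show (1 : ℕ) + 1 = 2 from rfl] at h1
  rw [show (0 : ℕ) + 1 = 1 from rfl] at h0
  rw [h1, h0, Summit.QuantumAdvantage.AdviceFreeQNC0.wtPrefix_zero, zero_add]

/-- a TWO-SLOT strategy: the selector `s` fired at walk slots 0 and 2, nothing elsewhere. -/
def pair02 (s : (Fin (n + 2) → Bool) → Bool) : Fin (n + 2 + 1) → (Fin (n + 2) → Bool) → Bool :=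
  fun g u => decide (g.val = 0 ∨ g.val = 2) && s u

/-- its outcome: fired, and exactly one of the two labels `c + |u|` (slot 0), `c + 2 + |u| + W₂(u)` (slot 2) is live. -/
theorem ringWinU_pair02 (c : ℕ) (s : (Fin (n + 2) → Bool) → Bool) (u : Fin (n + 2) → Bool) :
    ringWinU c (pair02 s) u =
      (s u && Bool.xor (decide ((c + wt u) % 3 ≠ 0)) (decide ((c + 2 + (wt u + wtPrefix u 2)) % 3 ≠ 0))) := by
  unfold ringWinU pair02
  cases hs : s u
  · simp
  · have e : (univ.filter fun g : Fin (n + 2 + 1) =>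
        (decide (g.val = 0 ∨ g.val = 2) && true) = true ∧ (c + g.val + walkExp u g.val) % 3 ≠ 0) =
        (({(⟨0, by omega⟩ : Fin (n + 2 + 1)), ⟨2, by omega⟩} : Finset (Fin (n + 2 + 1))).filter
          fun g => (c + g.val + walkExp u g.val) % 3 ≠ 0) := by
      ext g
      simp only [Finset.mem_filter, Finset.mem_univ, true_and, Bool.and_true, decide_eq_true_eq,
        Finset.mem_insert, Finset.mem_singleton]
      constructor
      · rintro ⟨hg, hl⟩
        refine ⟨?_, hl⟩
        rcases hg with hg | hg
        · exact Or.inl (Fin.ext hg)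
        · exact Or.inr (Fin.ext hg)
      · rintro ⟨hg, hl⟩
        refine ⟨?_, hl⟩
        rcases hg with hg | hg
        · exact Or.inl (by rw [hg])
        · exact Or.inr (by rw [hg])
    rw [e, Finset.filter_insert, Finset.filter_singleton]
    simp only [walkExp, Summit.QuantumAdvantage.AdviceFreeQNC0.wtPrefix_zero, add_zero]
    by_cases h0 : (c + wt u) % 3 = 0 <;> by_cases h2 : (c + 2 + (wt u + wtPrefix u 2)) % 3 = 0 <;>
      simp [h0, h2]


end NullPair
end Summit.QuantumAdvantage.QuantumAdvantage.Theorems.OrderDial
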